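import Mathlib

/-!
# Line "perfect cell ⊗ powers" for `FibreDesignFamily` — DEAD (record), with the killing lemma

Crux item `stmt-MatrixMultiplication-18277` (`ReesMunnRealization.FibreDesignFamily`, the deciding leaf of the
typed decomposition of `BlockRestrictionFamily`, `stmt-MatrixMultiplication-4368`).

THE LINE (sound mechanism, proved below as `FibreDesignFamilyMirror_of`): strict fibre realizations are
multiplicative under powers of the host (`h2`), so ONE cell with loss exactly `1` — a PERFECT cell,
`(abe)² = n²|G|³`, in a group with `[G:A]² < |G|` (`h1`) — would give the whole constant-loss family
(`c = 1`; Archimedes for the power `N`; `(abe)^N = n^N (|G|^N)^{3/2}`).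

WHY IT IS DEAD (`b_le_n_of_surjective`, `no_realization_of_surjective_of_lt`, proved below): in a perfect
cell `χ : [a]×[e] → G` is a bijection (`ae = |G|`, `χ` injective), and then every cross product
`g_{ij} P[λ_{ij}, ι_{j'k}] h_{j'k}` (`j ≠ j'`) would be hit by `χ`, so `P` vanishes on all cross label
pairs and `j ↦ λ_{i₀ j}` is injective: `b ≤ n`.  But a perfect cell has `b = n|G|^{1/2} > n` as soon as
`|G| ≥ 4` (and `|G| ≤ 3` contradicts `[G:A]² < |G|` with `[G:A] ≥ 1`… only `|G| ∈ {2,3}`, `A = G`,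
`b = n√|G| ∉ ℕ`-or-`> n`).  Hence hypothesis `h1` is unsatisfiable and, more generally, powers of ANY
single cell have loss `c^N → 0`: a constant-loss fibre design family needs FRESH hosts for every `t`
(the same phenomenon as for Strassen-type and CKSU families recorded in the crux's why-might-fail).
What survives as guidance for constructors: `χ` must stay boundedly far from onto (`ae ≤ |G|/C`) while
`ab, be ≈ n|G|/C'`, i.e. the interesting regime is `|G| ≍ n²`, `a ≍ e ≍ n`, `b ≍ n²` — exactly the
collision-heavy regime left open by the refuters' Θ-injectivity lemma on `FibrePacking`.

Also recorded: the BC5 special case (`t = 1`, trivial group) showing the crux's body is inhabited in kind.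
This file is sorry-free (the two former stubs are hypotheses `h1`, `h2` of the composition theorem).
-/

set_option linter.dupNamespace false

noncomputable section

namespace Summit.MatrixMultiplication.MatrixMultiplication.Cruxes.BlockRestrictionFamily.PerfectCellPowers

/-- **Label injectivity under a surjective `χ`**: in a strict fibre realization with `χ` onto `G`
(and `a, e ≥ 1`), the middle index `j ↦ (φ (i₀, j)).1` is injective, hence `b ≤ n`. [folklore] -/
theorem b_le_n_of_surjective {G : Type} [Group G] {n a b e : ℕ} (P : Fin n → Fin n → Option G)
    (φ : Fin a × Fin b → Fin n × G) (ψ : Fin b × Fin e → Fin n × G) (χ : Fin a × Fin e → G)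
    (hreal : ∀ x y z, ((P (φ x).1 (ψ y).1).map (fun p => (φ x).2 * p * (ψ y).2) = some (χ z) ↔
      (z.1 = x.1 ∧ x.2 = y.1 ∧ z.2 = y.2)))
    (hχ : Function.Surjective χ) (ha : 1 ≤ a) (he : 1 ≤ e) : b ≤ n := by
  -- the map `j ↦ λ_{i₀ j}` is injective
  let i₀ : Fin a := ⟨0, ha⟩
  let k₀ : Fin e := ⟨0, he⟩
  have hinj : Function.Injective fun j : Fin b => (φ (i₀, j)).1 := by
    intro j j' hjj
    by_contra hne
    -- the matching pair `(j', j')` has a non-zero sandwich entry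
    have hmatch := (hreal (i₀, j') (j', k₀) (i₀, k₀)).mpr ⟨rfl, rfl, rfl⟩
    cases hP : P (φ (i₀, j')).1 (ψ (j', k₀)).1 with
    | none => rw [hP] at hmatch; simp at hmatch
    | some p =>
      -- the cross pair `(j, j')` sees the same entry, and its value is hit by `χ`
      obtain ⟨z, hz⟩ := hχ ((φ (i₀, j)).2 * p * (ψ (j', k₀)).2)
      have hcross := (hreal (i₀, j) (j', k₀) z).mp (by
        simp only at hjj
        rw [hjj, hP, Option.map_some, hz])
      exact hne hcross.2.1
  simpa using Fintype.card_le_of_injective _ hinj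

/-- **No perfect cell**: with `χ` surjective, `a, e ≥ 1` and `n < b` there is no strict fibre
realization — in particular none with `(abe)² = n²|G|³` and `|G| ≥ 4` (`a = e = |G|^{1/2}`,
`b = n|G|^{1/2}`), so `stub_perfect_cell` of the line "perfect cell ⊗ powers" is FALSE. [folklore] -/
theorem no_realization_of_surjective_of_lt {G : Type} [Group G] {n a b e : ℕ}
    (P : Fin n → Fin n → Option G)
    (φ : Fin a × Fin b → Fin n × G) (ψ : Fin b × Fin e → Fin n × G) (χ : Fin a × Fin e → G)
    (hχ : Function.Surjective χ) (ha : 1 ≤ a) (he : 1 ≤ e) (hb : n < b) :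
    ¬ ∀ x y z, ((P (φ x).1 (ψ y).1).map (fun p => (φ x).2 * p * (ψ y).2) = some (χ z) ↔
      (z.1 = x.1 ∧ x.2 = y.1 ∧ z.2 = y.2)) :=
  fun hreal => absurd (b_le_n_of_surjective P φ ψ χ hreal hχ ha he) (not_le.mpr hb)


/-- Local mirror of the route decl `ReesMunnRealization.FibreDesignFamily` (identical term; the
composition is re-targeted to the route decl in `FibreDesignFamily_of`). -/
def FibreDesignFamilyMirror : Prop :=
  ∃ c : ℝ, 0 < c ∧ ∀ t : ℕ, ∃ (G : Type) (_ : Group G) (_ : Fintype G) (A : Subgroup G) (n a b e : ℕ) (P : Fin n → Fin n → Option G) (φ : Fin a × Fin b → Fin n × G) (ψ : Fin b × Fin e → Fin n × G) (χ : Fin a × Fin e → G), (∀ x ∈ A, ∀ y ∈ A, x * y = y * x) ∧ 1 ≤ n ∧ t * A.index ^ 2 ≤ Fintype.card G ∧ (∀ x y z, ((P (φ x).1 (ψ y).1).map (fun p => (φ x).2 * p * (ψ y).2) = some (χ z) ↔ (z.1 = x.1 ∧ x.2 = y.1 ∧ z.2 = y.2))) ∧ c * ((n : ℝ) * (Fintype.card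 G : ℝ) ^ ((3 : ℝ) / 2)) ≤ ((a * b * e : ℕ) : ℝ)

/-- COMPOSITION (proved): one perfect cell and multiplicativity give the constant-loss (`c = 1`)
fibre design family: take the `N`-th power with `t·([G:A]²)^N ≤ |G|^N` (`|G|/[G:A]² > 1`,
Archimedes); `|G^N| = |G|^N`, `n^N ≥ 1`, and `(abe)^N = (n|G|^(3/2))^N = n^N (|G|^N)^(3/2)`. -/
theorem FibreDesignFamilyMirror_of
    (h1 : ∃ (G : Type) (_ : Group G) (_ : Fintype G) (A : Subgroup G) (n a b e : ℕ)
      (P : Fin n → Fin n → Option G) (φ : Fin a × Fin b → Fin n × G) (ψ : Fin b × Fin e → Fin n × G)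
      (χ : Fin a × Fin e → G),
      (∀ x ∈ A, ∀ y ∈ A, x * y = y * x) ∧ 1 ≤ n ∧ A.index ^ 2 < Fintype.card G ∧
      (∀ x y z, ((P (φ x).1 (ψ y).1).map (fun p => (φ x).2 * p * (ψ y).2) = some (χ z) ↔
        (z.1 = x.1 ∧ x.2 = y.1 ∧ z.2 = y.2))) ∧
      (a * b * e) ^ 2 = n ^ 2 * Fintype.card G ^ 3)
    (h2 : ∀ (G : Type) [Group G] [Fintype G] (A : Subgroup G) (n a b e : ℕ)
      (P : Fin n → Fin n → Option G) (φ : Fin a × Fin b → Fin n × G) (ψ : Fin b × Fin e → Fin n × G)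
      (χ : Fin a × Fin e → G),
      (∀ x ∈ A, ∀ y ∈ A, x * y = y * x) →
      (∀ x y z, ((P (φ x).1 (ψ y).1).map (fun p => (φ x).2 * p * (ψ y).2) = some (χ z) ↔
        (z.1 = x.1 ∧ x.2 = y.1 ∧ z.2 = y.2))) →
      ∀ N : ℕ, ∃ (A' : Subgroup (Fin N → G)) (P' : Fin (n ^ N) → Fin (n ^ N) → Option (Fin N → G))
        (φ' : Fin (a ^ N) × Fin (b ^ N) → Fin (n ^ N) × (Fin N → G))
        (ψ' : Fin (b ^ N) × Fin (e ^ N) → Fin (n ^ N) × (Fin N → G))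
        (χ' : Fin (a ^ N) × Fin (e ^ N) → (Fin N → G)),
        (∀ x ∈ A', ∀ y ∈ A', x * y = y * x) ∧ A'.index = A.index ^ N ∧
        (∀ x y z, ((P' (φ' x).1 (ψ' y).1).map (fun p => (φ' x).2 * p * (ψ' y).2) = some (χ' z) ↔
          (z.1 = x.1 ∧ x.2 = y.1 ∧ z.2 = y.2)))) :
    FibreDesignFamilyMirror := by
  obtain ⟨G, _iG, _iF, A, n, a, b, e, P, φ, ψ, χ, hA, hn, hk, hreal, hperf⟩ := h1
  refine ⟨1, one_pos, fun t => ?_⟩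
  -- the index `k = [G:A] ≥ 1` and the ratio `|G| / k² > 1`
  have hk1 : 1 ≤ A.index := Nat.one_le_iff_ne_zero.mpr A.index_ne_zero_of_finite
  have hkpos : (0 : ℝ) < ((A.index : ℝ) ^ 2) := by positivity
  have hratio : (1 : ℝ) < (Fintype.card G : ℝ) / (A.index : ℝ) ^ 2 := by
    rw [one_lt_div hkpos]
    exact_mod_cast hk
  -- choose the power `N` with `t · (k²)^N ≤ |G|^N`
  obtain ⟨N, hN⟩ := pow_unbounded_of_one_lt (t : ℝ) hratio
  have hNnat : t * (A.index ^ 2) ^ N ≤ Fintype.card G ^ N := by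
    rw [div_pow, lt_div_iff₀ (pow_pos hkpos N)] at hN
    exact_mod_cast hN.le
  -- the `N`-th power of the cell
  obtain ⟨A', P', φ', ψ', χ', hA', hidx, hreal'⟩ := h2 G A n a b e P φ ψ χ hA hreal N
  refine ⟨Fin N → G, inferInstance, inferInstance, A', n ^ N, a ^ N, b ^ N, e ^ N, P', φ', ψ', χ',
    hA', Nat.one_le_pow _ _ hn, ?_, hreal', ?_⟩
  · -- comparability: `t · ([G:A]^N)² ≤ |G|^N = |G^N|`
    rw [hidx, Fintype.card_fun, Fintype.card_fin, ← pow_mul, mul_comm N 2, pow_mul]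
    exact hNnat
  · -- packing with `c = 1`: `(abe)^N = (n |G|^{3/2})^N = n^N · (|G|^N)^{3/2}`
    rw [Fintype.card_fun, Fintype.card_fin, one_mul]
    have hg0 : (0 : ℝ) ≤ (Fintype.card G : ℝ) := Nat.cast_nonneg _
    have hn0 : (0 : ℝ) ≤ (n : ℝ) := Nat.cast_nonneg _
    -- `abe = n · |G|^{3/2}` from `(abe)² = n² |G|³`
    have hsq : (((a * b * e : ℕ) : ℝ)) ^ 2 = ((n : ℝ) * (Fintype.card G : ℝ) ^ ((3 : ℝ) / 2)) ^ 2 := by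
      have h1 : (((a * b * e : ℕ) : ℝ)) ^ 2 = (n : ℝ) ^ 2 * (Fintype.card G : ℝ) ^ 3 := by
        exact_mod_cast hperf
      rw [h1, mul_pow, ← Real.rpow_natCast ((Fintype.card G : ℝ) ^ ((3 : ℝ) / 2)) 2,
        ← Real.rpow_mul hg0, ← Real.rpow_natCast (Fintype.card G : ℝ) 3]
      norm_num
    have heq : (((a * b * e : ℕ) : ℝ)) = (n : ℝ) * (Fintype.card G : ℝ) ^ ((3 : ℝ) / 2) :=
      (sq_eq_sq₀ (Nat.cast_nonneg _) (mul_nonneg hn0 (Real.rpow_nonneg hg0 _))).mp hsq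
    -- `(|G|^N)^{3/2} = (|G|^{3/2})^N`
    have hpow : (((Fintype.card G ^ N : ℕ) : ℝ)) ^ ((3 : ℝ) / 2) =
        ((Fintype.card G : ℝ) ^ ((3 : ℝ) / 2)) ^ N := by
      push_cast
      rw [← Real.rpow_natCast (Fintype.card G : ℝ) N, ← Real.rpow_mul hg0, mul_comm,
        Real.rpow_mul_natCast hg0]
    have hfin : ((n ^ N : ℕ) : ℝ) * (((Fintype.card G ^ N : ℕ) : ℝ)) ^ ((3 : ℝ) / 2) =
        (((a ^ N * b ^ N * e ^ N : ℕ) : ℝ)) := by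
      rw [hpow]
      have h3 : (((a ^ N * b ^ N * e ^ N : ℕ) : ℝ)) = (((a * b * e : ℕ) : ℝ)) ^ N := by
        push_cast; ring
      rw [h3, heq, mul_pow]
      push_cast
      ring
    exact hfin.le


/-- BC5 SPECIAL CASE (definitions compute; the crux is inhabited-in-kind at `t ≤ 1`): the inner body
of `FibreDesignFamily` for `t = 1`, `c = 1`, in the trivial group with `n = a = b = e = 1`. -/
theorem fibreDesign_body_t_one :
    ∃ (G : Type) (_ : Group G) (_ : Fintype G) (A : Subgroup G) (n a b e : ℕ)
      (P : Fin n → Fin n → Option G) (φ : Fin a × Fin b → Fin n × G) (ψ : Fin b × Fin e → Fin n × G)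
      (χ : Fin a × Fin e → G),
      (∀ x ∈ A, ∀ y ∈ A, x * y = y * x) ∧ 1 ≤ n ∧ 1 * A.index ^ 2 ≤ Fintype.card G ∧
      (∀ x y z, ((P (φ x).1 (ψ y).1).map (fun p => (φ x).2 * p * (ψ y).2) = some (χ z) ↔
        (z.1 = x.1 ∧ x.2 = y.1 ∧ z.2 = y.2))) ∧
      (1 : ℝ) * ((n : ℝ) * (Fintype.card G : ℝ) ^ ((3 : ℝ) / 2)) ≤ ((a * b * e : ℕ) : ℝ) := by
  refine ⟨PUnit, inferInstance, inferInstance, ⊤, 1, 1, 1, 1, fun _ _ => some PUnit.unit,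
    fun _ => (0, PUnit.unit), fun _ => (0, PUnit.unit), fun _ => PUnit.unit, ?_, le_rfl, ?_, ?_, ?_⟩
  · intro x _ y _
    rfl
  · simp
  · intro x y z
    simp only [Option.map_some, true_iff]
    exact ⟨Subsingleton.elim _ _, Subsingleton.elim _ _, Subsingleton.elim _ _⟩
  · simp


end Summit.MatrixMultiplication.MatrixMultiplication.Cruxes.BlockRestrictionFamily.PerfectCellPowers

end
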